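import Mathlib.AlgebraicGeometry.Noetherian
import Mathlib.AlgebraicGeometry.Stalk
import Mathlib.AlgebraicGeometry.Properties
import Mathlib.RingTheory.Ideal.KrullsHeightTheorem
import Mathlib.Topology.Sober
import HarnessLib

/-!
# [OURS · L1 W4.2] DEPTH AT A MARKED POINT DOES NOT JUMP ACROSS A ONE-POINT FIBRE — the commutative algebra
# (Matsumura's dimension inequality on the stalks) behind the SURFACE branch of row (b-jump) / ROW-J of the W-ladder

Crux chain w42 (`SigmaMaxModifications`, stmt-ResolutionOfSingularities-18506; conjunct `SigmaMaxModificationsCorridor3`,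
stmt-ResolutionOfSingularities-19249; skeleton `w_ladder` v7), res-L1-w42-plan-1 RULINGS v3.13-4 (AR) 09:13:08Z «ROW-J CLOSER»
→ res-D-brk-3 (gen 5). OURS (cell res-hironaka, slot W4.2); NOT statements of H. Hironaka's manuscript [Hironaka2017] nor of
[CossartJannsenSaito2020]; AI-written, weaker than expert review. Helper file `--supports stmt-ResolutionOfSingularities-19249`
(counted 0). EVERY DECLARATION HERE IS A PROVED THEOREM of general scheme theory (no OURS claim, no named fact, no binder):
it is the geometric input the ROW-J closer (`…Corridor3WLadderStrataBirthsTopRebirthClose`) needs in the SURFACE branch of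
`CycleEndCentreDichotomy3` (near fibre over the chain point a subsingleton), where pure label/closure bookkeeping cannot
conclude (a 3-point chain mapping onto a 2-point base is a topological countermodel): the missing input is DIMENSION THEORY.

## What is proved (namespace `…Theorems.SigmaMaxModificationsCorridor3.Helpers`)

* §1 `exists_prime_between_comap_of_fibre` — RELATIVE MATSUMURA WITH A ONE-POINT FIBRE (pure algebra): for a ring map
  `φ : A → B` of Noetherian rings and primes `𝔮' < 𝔟' < 𝔫` of `B` such that `𝔫` is the only prime `𝔓` with `𝔮' ≤ 𝔓 ≤ 𝔫`
  and `φ⁻¹𝔫 ≤ φ⁻¹𝔓`, some prime of `A` lies STRICTLY between `φ⁻¹𝔮'` and `φ⁻¹𝔫`. Proof: in `S = B/𝔮'` over `R = A/φ⁻¹𝔮'`,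
  `ht(𝔫 S) ≥ 2` (the chain) while the image of `𝔫` in `S/𝔪_R S` is a minimal prime (the fibre hypothesis), so Mathlib's
  `Ideal.height_le_height_add_of_liesOver` (`ht 𝔓 ≤ ht 𝔭 + ht(𝔓 · S/𝔭S)`, Matsumura Thm. 15.1) gives `ht(𝔪_R) ≥ 2`, and
  `Ideal.height_le_iff` produces the intermediate prime.
* §2 the STALK PICTURE (`Scheme.fromSpecStalk`): `fromSpecStalk_asIdeal_le_iff` (inclusion of primes of `𝒪_{X,x}` =
  specialisation of the corresponding points — `Spec 𝒪_{X,x} → X` is a topological embedding, Mathlib `IsPreimmersion`),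
  `exists_fromSpecStalk_eq` (points specialising to `x` come from `Spec 𝒪_{X,x}`, Mathlib `Scheme.range_fromSpecStalk`),
  `base_fromSpecStalk_eq` (naturality `f ∘ ι_x = ι_{f x} ∘ Spec(φ_x)`, Mathlib `Scheme.SpecMap_stalkMap_fromSpecStalk`), and the
  elementary `closure_image_closure_singleton'`.
* §3 `exists_sandwich_image_of_fibre_subset` — **DEPTH DOES NOT JUMP ACROSS A ONE-POINT FIBRE**: for a morphism `f : X → Y` of
  locally Noetherian schemes, a closed point `x`, irreducible closed `{x} ⊊ B' ⊊ Z'` through `x` (a «sandwich»: `Z'` has depth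
  `≥ 2` at `x`) with `Z' ∩ f⁻¹(f x) ⊆ {x}`, the image closure `closure f(Z')` has a sandwich at `f x` (depth `≥ 2` at `f x`).
  Proof: generic points `ζ ⤳ β ⤳ x` ↦ primes `𝔮' < 𝔟' < 𝔪_x`; the fibre hypothesis read on primes; §1; the intermediate prime
  of `𝒪_{Y,f x}` ↦ a point `b` with `η ⤳ b ⤳ f x`, `b ≠ η, f x` (`η = f ζ` the generic point of the image closure);
  `B = closure {b}`.

Consumer: the ROW-J closer reads §3 on the step projection `X_{n+1} → X_n` at the chain point with `Z'` an irreducible component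
of `X_{n+1}(ν)` through `x_{n+1}`: in the surface branch the near fibre `f⁻¹(x_n) ∩ X_{n+1}(ν)` is `{x_{n+1}}`, so a depth jump
`HasSandwichAt (c (n+1)) Z' ∧ ¬ HasSandwichAt (c n) (closure f(Z'))` is impossible outright — no dictionary, no claim.

References: H. Matsumura, *Commutative Ring Theory*, Thm. 15.1 [Matsumura1987]; U. Görtz, T. Wedhorn, *Algebraic Geometry I*,
Lemma 14.109 [GortzWedhorn2020]; Mathlib `Mathlib.RingTheory.Ideal.KrullsHeightTheorem`, `Mathlib.AlgebraicGeometry.Stalk`;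
HOME STATUS res-L1-w42-plan-1 RULINGS v3.13-4 (AR) 09:13:08Z, res-D-brk-3 PACE #1 09:31:26Z.
-/

noncomputable section

set_option linter.dupNamespace false

open CategoryTheory AlgebraicGeometry TopologicalSpace Topology

universe u

namespace Summit.ResolutionOfSingularities.ResolutionOfSingularities.Theorems.SigmaMaxModificationsCorridor3.Helpers

/-! ## §1. Algebra: a chain of two primes upstairs over a trivial fibre forces a prime strictly in between downstairs -/

/-- **Relative Matsumura (Thm. 15.1) with a one-point fibre.** Let `φ : A → B` be a ring homomorphism with `B` Noetherian and
`𝔮' < 𝔟' < 𝔫` primes of `B` such that the only prime `𝔓` with `𝔮' ≤ 𝔓 ≤ 𝔫` lying over (a prime containing) `φ⁻¹𝔫` is `𝔫`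
itself. Then some prime `𝔟` of `A` lies strictly between `φ⁻¹𝔮'` and `φ⁻¹𝔫`: indeed `ht(𝔫/𝔮') ≥ 2` while the fibre ring of
`A/φ⁻¹𝔮' → B/𝔮'` at `φ⁻¹𝔫` has `𝔫` as a minimal prime, so `ht(φ⁻¹𝔫/φ⁻¹𝔮') ≥ 2` by
`dim B_𝔓 ≤ dim A_𝔭 + dim (B_𝔓 / 𝔭B_𝔓)` (Mathlib `Ideal.height_le_height_add_of_liesOver`). [folklore] -/
theorem exists_prime_between_comap_of_fibre {A B : Type*} [CommRing A] [CommRing B] [IsNoetherianRing A]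
    [IsNoetherianRing B]
    (φ : A →+* B) {𝔮' 𝔟' 𝔫 : Ideal B} [𝔮'.IsPrime] [𝔟'.IsPrime] [𝔫.IsPrime] (h₁ : 𝔮' < 𝔟') (h₂ : 𝔟' < 𝔫)
    (hfib : ∀ 𝔓 : Ideal B, 𝔓.IsPrime → 𝔮' ≤ 𝔓 → 𝔓 ≤ 𝔫 → 𝔫.comap φ ≤ 𝔓.comap φ → 𝔓 = 𝔫) :
    ∃ 𝔟 : Ideal A, 𝔟.IsPrime ∧ 𝔮'.comap φ < 𝔟 ∧ 𝔟 < 𝔫.comap φ := by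
  classical
  have h𝔮'𝔫 : 𝔮' ≤ 𝔫 := h₁.le.trans h₂.le
  have h𝔮𝔫₀ : 𝔮'.comap φ ≤ 𝔫.comap φ := Ideal.comap_mono h𝔮'𝔫
  -- the quotients `R = A/φ⁻¹𝔮'`, `S = B/𝔮'` and the induced algebra
  let ψ : A ⧸ 𝔮'.comap φ →+* B ⧸ 𝔮' := Ideal.quotientMap 𝔮' φ le_rfl
  letI : Algebra (A ⧸ 𝔮'.comap φ) (B ⧸ 𝔮') := ψ.toAlgebra
  have halg : ∀ a : A, algebraMap (A ⧸ 𝔮'.comap φ) (B ⧸ 𝔮') (Ideal.Quotient.mk _ a) = Ideal.Quotient.mk 𝔮' (φ a) :=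
    fun a => Ideal.quotientMap_mk
  -- comap along the two quotient maps
  have hcomapS : ∀ I : Ideal B, 𝔮' ≤ I → (I.map (Ideal.Quotient.mk 𝔮')).comap (Ideal.Quotient.mk 𝔮') = I := fun I hI => by
    rw [Ideal.comap_map_of_surjective _ Ideal.Quotient.mk_surjective, ← RingHom.ker_eq_comap_bot, Ideal.mk_ker,
      sup_eq_left.mpr hI]
  have hcomapR : ∀ I : Ideal A, 𝔮'.comap φ ≤ I →
      (I.map (Ideal.Quotient.mk (𝔮'.comap φ))).comap (Ideal.Quotient.mk (𝔮'.comap φ)) = I := fun I hI => by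
    rw [Ideal.comap_map_of_surjective _ Ideal.Quotient.mk_surjective, ← RingHom.ker_eq_comap_bot, Ideal.mk_ker,
      sup_eq_left.mpr hI]
  -- the primes upstairs: `⊥ < Q₁ < P`
  set P : Ideal (B ⧸ 𝔮') := 𝔫.map (Ideal.Quotient.mk 𝔮') with hPdef
  set Q₁ : Ideal (B ⧸ 𝔮') := 𝔟'.map (Ideal.Quotient.mk 𝔮') with hQ₁def
  haveI hP : P.IsPrime :=
    Ideal.map_isPrime_of_surjective Ideal.Quotient.mk_surjective (by rw [Ideal.mk_ker]; exact h𝔮'𝔫)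
  haveI hQ₁ : Q₁.IsPrime :=
    Ideal.map_isPrime_of_surjective Ideal.Quotient.mk_surjective (by rw [Ideal.mk_ker]; exact h₁.le)
  have hbotQ₁ : (⊥ : Ideal (B ⧸ 𝔮')) < Q₁ := by
    rw [bot_lt_iff_ne_bot]
    intro h
    refine h₁.ne (le_antisymm h₁.le fun b hb => ?_)
    have hb' : Ideal.Quotient.mk 𝔮' b ∈ Q₁ := Ideal.mem_map_of_mem _ hb
    rw [h, Ideal.mem_bot, Ideal.Quotient.eq_zero_iff_mem] at hb'
    exact hb'
  have hQ₁P : Q₁ < P := by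
    refine lt_of_le_of_ne (Ideal.map_mono h₂.le) fun h => h₂.ne ?_
    have := congrArg (Ideal.comap (Ideal.Quotient.mk 𝔮')) h
    rwa [hcomapS _ h₁.le, hcomapS _ h𝔮'𝔫] at this
  have hPht : (2 : ℕ∞) ≤ P.height := by
    have e1 : (1 : ℕ∞) ≤ Q₁.height := le_add_self.trans (Ideal.height_add_one_le_of_lt_of_isPrime hbotQ₁)
    have e2 := Ideal.height_add_one_le_of_lt_of_isPrime hQ₁P
    calc (2 : ℕ∞) = 1 + 1 := by norm_num
      _ ≤ Q₁.height + 1 := by gcongr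
      _ ≤ P.height := e2
  -- the prime downstairs and `P` lies over it
  set p : Ideal (A ⧸ 𝔮'.comap φ) := (𝔫.comap φ).map (Ideal.Quotient.mk (𝔮'.comap φ)) with hpdef
  haveI hp : p.IsPrime :=
    Ideal.map_isPrime_of_surjective Ideal.Quotient.mk_surjective (by rw [Ideal.mk_ker]; exact h𝔮𝔫₀)
  haveI hover : P.LiesOver p := by
    refine ⟨?_⟩
    ext r
    obtain ⟨a, rfl⟩ := Ideal.Quotient.mk_surjective r
    rw [Ideal.mem_quotient_iff_mem h𝔮𝔫₀, Ideal.under_def, Ideal.mem_comap, Ideal.mem_comap, halg, hPdef,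
      Ideal.mem_quotient_iff_mem h𝔮'𝔫]
  -- the fibre term vanishes: `P (S/pS)` is a minimal prime
  have hpSP : p.map (algebraMap _ (B ⧸ 𝔮')) ≤ P := Ideal.map_le_iff_le_comap.mpr (le_of_eq hover.over)
  have hF : (P.map (Ideal.Quotient.mk (p.map (algebraMap _ (B ⧸ 𝔮'))))).height = 0 := by
    set pS := p.map (algebraMap _ (B ⧸ 𝔮')) with hpSdef
    haveI : (P.map (Ideal.Quotient.mk pS)).IsPrime :=
      Ideal.map_isPrime_of_surjective Ideal.Quotient.mk_surjective (by rwa [Ideal.mk_ker])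
    rw [Ideal.height_eq_zero_iff]
    refine ⟨⟨inferInstance, bot_le⟩, fun Q hQ hQle => ?_⟩
    haveI : Q.IsPrime := hQ.1
    -- pull `Q` back to `B`
    set 𝔓₁ : Ideal (B ⧸ 𝔮') := Q.comap (Ideal.Quotient.mk pS) with h𝔓₁
    set 𝔓 : Ideal B := 𝔓₁.comap (Ideal.Quotient.mk 𝔮') with h𝔓
    have h𝔮'𝔓 : 𝔮' ≤ 𝔓 := by
      intro b hb
      rw [h𝔓, Ideal.mem_comap, Ideal.Quotient.eq_zero_iff_mem.mpr hb]
      exact 𝔓₁.zero_mem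
    have h𝔓₁P : 𝔓₁ ≤ P := by
      refine (Ideal.comap_mono hQle).trans ?_
      rw [Ideal.comap_map_of_surjective _ Ideal.Quotient.mk_surjective, ← RingHom.ker_eq_comap_bot, Ideal.mk_ker]
      exact sup_le le_rfl hpSP
    have h𝔓𝔫 : 𝔓 ≤ 𝔫 := by
      refine (Ideal.comap_mono h𝔓₁P).trans ?_
      rw [hPdef, hcomapS _ h𝔮'𝔫]
    have hfibre : 𝔫.comap φ ≤ 𝔓.comap φ := by
      intro a ha
      rw [Ideal.mem_comap] at ha ⊢
      rw [h𝔓, Ideal.mem_comap, h𝔓₁, Ideal.mem_comap]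
      have hmem : Ideal.Quotient.mk 𝔮' (φ a) ∈ pS := by
        rw [← halg]
        exact Ideal.mem_map_of_mem _ (Ideal.mem_map_of_mem _ (Ideal.mem_comap.mpr ha))
      rw [Ideal.Quotient.eq_zero_iff_mem.mpr hmem]
      exact Q.zero_mem
    have h𝔓eq : 𝔓 = 𝔫 := hfib 𝔓 inferInstance h𝔮'𝔓 h𝔓𝔫 hfibre
    have h𝔓₁eq : 𝔓₁ = P := by
      rw [← Ideal.map_comap_of_surjective (Ideal.Quotient.mk 𝔮') Ideal.Quotient.mk_surjective 𝔓₁, ← h𝔓, h𝔓eq]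
    rw [← h𝔓₁eq, h𝔓₁, Ideal.map_comap_of_surjective _ Ideal.Quotient.mk_surjective]
  -- Matsumura on the quotients
  have hM := Ideal.height_le_height_add_of_liesOver p P
  rw [hF, add_zero] at hM
  have hpht : (2 : ℕ∞) ≤ p.height := hPht.trans hM
  -- a prime strictly between `⊥` and `p` in `A/φ⁻¹𝔮'`
  have hnot : ¬ p.height ≤ (1 : ℕ) := by
    intro h
    have := hpht.trans (by exact_mod_cast h)
    norm_num at this
  rw [Ideal.height_le_iff] at hnot
  simp only [not_forall, not_lt, exists_prop] at hnot
  obtain ⟨q, hq, hqp, hqht⟩ := hnot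
  have hqne : q ≠ ⊥ := by
    rintro rfl
    rw [Ideal.height_bot] at hqht
    norm_num at hqht
  refine ⟨q.comap (Ideal.Quotient.mk _), inferInstance, lt_of_le_of_ne ?_ ?_, lt_of_le_of_ne ?_ ?_⟩
  · intro a ha
    rw [Ideal.mem_comap, Ideal.Quotient.eq_zero_iff_mem.mpr ha]
    exact q.zero_mem
  · intro h
    apply hqne
    rw [← Ideal.map_comap_of_surjective (Ideal.Quotient.mk (𝔮'.comap φ)) Ideal.Quotient.mk_surjective q, ← h,
      Ideal.map_quotient_self]
  · refine (Ideal.comap_mono hqp.le).trans ?_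
    rw [hpdef, hcomapR _ h𝔮𝔫₀]
  · intro h
    apply hqp.ne
    rw [← Ideal.map_comap_of_surjective (Ideal.Quotient.mk (𝔮'.comap φ)) Ideal.Quotient.mk_surjective q, h, hpdef]


/-! ## §2. Points specialising to `x` as primes of the stalk `𝒪_{X,x}` -/

/-- The closure of the image of the closure of a point is the closure of the image of the point. [folklore] -/
theorem closure_image_closure_singleton' {α β : Type*} [TopologicalSpace α] [TopologicalSpace β] {f : α → β}
    (hf : Continuous f) (a : α) : closure (f '' closure {a}) = closure {f a} := by
  refine Set.Subset.antisymm (closure_minimal ?_ isClosed_closure) (closure_mono ?_)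
  · refine (image_closure_subset_closure_image hf).trans ?_
    rw [Set.image_singleton]
  · rw [← Set.image_singleton]
    exact Set.image_mono subset_closure

/-- **Inclusion of primes of `𝒪_{X,x}` is specialisation of the corresponding points of `X`** (the canonical
`Spec 𝒪_{X,x} → X` is a topological embedding onto the points specialising to `x`). [folklore] -/
theorem fromSpecStalk_asIdeal_le_iff {X : Scheme.{u}} (x : X) (a b : Spec (X.presheaf.stalk x)) :
    a.asIdeal ≤ b.asIdeal ↔ X.fromSpecStalk x a ⤳ X.fromSpecStalk x b := by
  rw [PrimeSpectrum.asIdeal_le_asIdeal, PrimeSpectrum.le_iff_specializes,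
    (X.fromSpecStalk x).isEmbedding.isInducing.specializes_iff]
  exact Iff.rfl

/-- Every point specialising to `x` is the image of a (unique) prime of `𝒪_{X,x}`. [folklore] -/
theorem exists_fromSpecStalk_eq {X : Scheme.{u}} {x z : X} (h : z ⤳ x) :
    ∃ a : Spec (X.presheaf.stalk x), X.fromSpecStalk x a = z := by
  have : z ∈ Set.range (X.fromSpecStalk x) := by
    rw [Scheme.range_fromSpecStalk]
    exact h
  exact this

/-- **Naturality of the stalk picture**: `f` maps the point of `X` defined by the prime `𝔓 ⊆ 𝒪_{X,x}` to the point of `Y`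
defined by its preimage `φ⁻¹𝔓 ⊆ 𝒪_{Y,f x}` under the stalk map `φ`. [folklore] -/
theorem base_fromSpecStalk_eq {X Y : Scheme.{u}} (f : X ⟶ Y) (x : X) (a : Spec (X.presheaf.stalk x)) :
    f.base (X.fromSpecStalk x a) = Y.fromSpecStalk (f.base x) (Spec.map (f.stalkMap x) a) := by
  rw [← Scheme.Hom.comp_apply, ← Scheme.Hom.comp_apply, Scheme.SpecMap_stalkMap_fromSpecStalk]

/-! ## §3. Depth does not jump across a finite fibre -/

/-- **DEPTH AT A POINT DOES NOT JUMP ACROSS A ONE-POINT FIBRE.** Let `f : X → Y` be a morphism of locally Noetherian schemes,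
`x ∈ X` a closed point, `Z' ⊆ X` irreducible closed with a SANDWICH at `x` — an irreducible closed `B'` with
`{x} ⊊ B' ⊊ Z'`, `x ∈ B'` — and suppose the fibre of `Z'` over `f x` is `{x}` alone. Then the image closure
`Z = closure f(Z')` has a sandwich at `f x`. Proof: the generic points `ζ ⤳ β ⤳ x` of `Z' ⊋ B'` give primes
`𝔮' < 𝔟' < 𝔪` of `𝒪_{X,x}`; the fibre hypothesis says `𝔪` is the only prime between `𝔮'` and `𝔪` over `𝔪_{f x}`; so
`ht(𝔪_{f x}/φ⁻¹𝔮') ≥ 2` (`exists_prime_between_comap_of_fibre`) and a prime strictly between `φ⁻¹𝔮'` (the generic point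
of `Z`) and `𝔪_{f x}` is a point `b` with `η_Z ⤳ b ⤳ f x`, `b ≠ η_Z, f x`; `B = closure {b}`. [folklore] -/
theorem exists_sandwich_image_of_fibre_subset {X Y : Scheme.{u}} [IsLocallyNoetherian X] [IsLocallyNoetherian Y]
    (f : X ⟶ Y) {x : X} (hx : IsClosed ({x} : Set X)) {Z' B' : Set X}
    (hZ'irr : IsIrreducible Z') (hZ'cl : IsClosed Z') (hB'irr : IsIrreducible B') (hB'cl : IsClosed B')
    (hxB' : x ∈ B') (hB'Z' : B' ⊆ Z') (hB'x : B' ≠ {x}) (hB'ne : B' ≠ Z')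
    (hfib : Z' ∩ f.base ⁻¹' {f.base x} ⊆ {x}) :
    ∃ B : Set Y, IsIrreducible B ∧ IsClosed B ∧ f.base x ∈ B ∧ B ⊆ closure (f.base '' Z') ∧
      B ≠ {f.base x} ∧ B ≠ closure (f.base '' Z') := by
  classical
  -- generic points upstairs
  have hζ : IsGenericPoint hZ'irr.genericPoint Z' := hZ'irr.isGenericPoint_genericPoint hZ'cl
  have hβ : IsGenericPoint hB'irr.genericPoint B' := hB'irr.isGenericPoint_genericPoint hB'cl
  set ζ := hZ'irr.genericPoint
  set β := hB'irr.genericPoint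
  have hζx : ζ ⤳ x := hζ.specializes (hB'Z' hxB')
  have hβx : β ⤳ x := hβ.specializes hxB'
  have hζβ : ζ ⤳ β := hζ.specializes (hB'Z' hβ.mem)
  -- as primes of `𝒪_{X,x}`
  obtain ⟨q', hq'⟩ := exists_fromSpecStalk_eq hζx
  obtain ⟨b', hb'⟩ := exists_fromSpecStalk_eq hβx
  let φ : (Y.presheaf.stalk (f.base x) : Type u) →+* (X.presheaf.stalk x : Type u) := (f.stalkMap x).hom
  have hιinj : Function.Injective (X.fromSpecStalk x) := (X.fromSpecStalk x).isEmbedding.injective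
  have hιYinj : Function.Injective (Y.fromSpecStalk (f.base x)) := (Y.fromSpecStalk (f.base x)).isEmbedding.injective
  have hxpt : X.fromSpecStalk x (IsLocalRing.closedPoint (X.presheaf.stalk x)) = x := Scheme.fromSpecStalk_closedPoint
  have hypt : Y.fromSpecStalk (f.base x) (IsLocalRing.closedPoint (Y.presheaf.stalk (f.base x))) = f.base x := Scheme.fromSpecStalk_closedPoint
  -- the chain `𝔮' < 𝔟' < 𝔪`
  haveI : q'.asIdeal.IsPrime := q'.isPrime
  haveI : b'.asIdeal.IsPrime := b'.isPrime
  have h₁ : q'.asIdeal < b'.asIdeal := by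
    refine lt_of_le_of_ne ((fromSpecStalk_asIdeal_le_iff x q' b').mpr (by rw [hq', hb']; exact hζβ)) fun h => ?_
    have hqb : q' = b' := PrimeSpectrum.ext h
    apply hB'ne
    rw [← hζ.def, ← hβ.def, ← hq', ← hb', hqb]
  have h₂ : b'.asIdeal < (IsLocalRing.closedPoint (X.presheaf.stalk x)).asIdeal := by
    refine lt_of_le_of_ne (IsLocalRing.le_maximalIdeal Ideal.IsPrime.ne_top') fun h => ?_
    have hb : b' = IsLocalRing.closedPoint (X.presheaf.stalk x) := PrimeSpectrum.ext h
    apply hB'x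
    rw [← hβ.def, ← hb', hb, hxpt, hx.closure_eq]
  -- the one-point fibre, read on primes
  have hfib' : ∀ 𝔓 : Ideal (X.presheaf.stalk x), 𝔓.IsPrime → q'.asIdeal ≤ 𝔓 → 𝔓 ≤ (IsLocalRing.closedPoint (X.presheaf.stalk x)).asIdeal →
      ((IsLocalRing.closedPoint (X.presheaf.stalk x)).asIdeal).comap φ ≤ 𝔓.comap φ → 𝔓 = (IsLocalRing.closedPoint (X.presheaf.stalk x)).asIdeal := by
    intro 𝔓 h𝔓 hq𝔓 h𝔓m hcomap
    let P : Spec (X.presheaf.stalk x) := ⟨𝔓, h𝔓⟩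
    -- the point `z` of `X` defined by `𝔓` lies in `Z'` …
    have hzZ' : X.fromSpecStalk x P ∈ Z' :=
      hζ.specializes_iff_mem.mp (hq' ▸ (fromSpecStalk_asIdeal_le_iff x q' P).mp hq𝔓)
    -- … and over `f x`: its prime of `𝒪_{Y, f x}` is `φ⁻¹𝔓 = 𝔪`
    have hmax : 𝔓.comap φ = IsLocalRing.maximalIdeal (Y.presheaf.stalk (f.base x)) := by
      refine le_antisymm (IsLocalRing.le_maximalIdeal Ideal.IsPrime.ne_top') ?_
      have : ((IsLocalRing.closedPoint (X.presheaf.stalk x)).asIdeal).comap φ = IsLocalRing.maximalIdeal (Y.presheaf.stalk (f.base x)) :=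
        congrArg PrimeSpectrum.asIdeal (IsLocalRing.comap_closedPoint φ)
      rw [← this]
      exact hcomap
    have hSpec : Spec.map (f.stalkMap x) P = IsLocalRing.closedPoint (Y.presheaf.stalk (f.base x)) := by
      rw [Spec.map_apply]
      exact PrimeSpectrum.ext hmax
    have hzf : f.base (X.fromSpecStalk x P) = f.base x := by
      rw [base_fromSpecStalk_eq, hSpec, hypt]
    have hz : X.fromSpecStalk x P = x := hfib ⟨hzZ', hzf⟩
    have hP : P = IsLocalRing.closedPoint (X.presheaf.stalk x) := hιinj (hz.trans hxpt.symm)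
    exact congrArg PrimeSpectrum.asIdeal hP
  -- Matsumura on the stalks: a prime strictly between `φ⁻¹𝔮'` and `𝔪_{f x}`
  obtain ⟨𝔟, h𝔟, hq𝔟, h𝔟m⟩ := exists_prime_between_comap_of_fibre φ h₁ h₂ hfib'
  have hmA : ((IsLocalRing.closedPoint (X.presheaf.stalk x)).asIdeal).comap φ = IsLocalRing.maximalIdeal (Y.presheaf.stalk (f.base x)) :=
    congrArg PrimeSpectrum.asIdeal (IsLocalRing.comap_closedPoint φ)
  -- the points `η = f ζ` (generic point of the image closure), `b`, and `f x`
  let bpt : Spec (Y.presheaf.stalk (f.base x)) := ⟨𝔟, h𝔟⟩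
  set b := Y.fromSpecStalk (f.base x) bpt with hbdef
  set η := Y.fromSpecStalk (f.base x) (Spec.map (f.stalkMap x) q') with hηdef
  have hηζ : η = f.base ζ := by rw [hηdef, ← base_fromSpecStalk_eq, hq']
  have hηb : η ⤳ b := by
    rw [hηdef, hbdef, ← fromSpecStalk_asIdeal_le_iff, Spec.map_apply]
    exact hq𝔟.le
  have hbx : b ⤳ f.base x := by
    have := (fromSpecStalk_asIdeal_le_iff (f.base x) bpt (IsLocalRing.closedPoint _)).mp
      (IsLocalRing.le_maximalIdeal h𝔟.ne_top')
    rwa [hypt] at this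
  have hbne : b ≠ f.base x := by
    intro h
    have := congrArg PrimeSpectrum.asIdeal (hιYinj (h.trans hypt.symm))
    exact h𝔟m.ne (this.trans hmA.symm)
  have hbη : b ≠ η := by
    intro h
    rw [hbdef, hηdef] at h
    have := congrArg PrimeSpectrum.asIdeal (hιYinj h)
    rw [Spec.map_apply] at this
    exact hq𝔟.ne this.symm
  -- the image closure is the closure of `η`
  have hclZ : closure (f.base '' Z') = closure {η} := by
    rw [hηζ, ← hζ.def]
    exact closure_image_closure_singleton' f.base.hom.continuous ζ
  refine ⟨closure {b}, isIrreducible_singleton.closure, isClosed_closure, hbx.mem_closure, ?_, ?_, ?_⟩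
  · rw [hclZ]
    exact hηb.closure_subset
  · intro h
    exact hbne (by simpa using (h ▸ subset_closure (Set.mem_singleton b) : b ∈ ({f.base x} : Set Y)))
  · rw [hclZ]
    intro h
    have hb' : IsGenericPoint b (closure {η}) := by
      rw [← h]
      exact isGenericPoint_closure
    exact hbη (hb'.eq isGenericPoint_closure)

end Summit.ResolutionOfSingularities.ResolutionOfSingularities.Theorems.SigmaMaxModificationsCorridor3.Helpers

end
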